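import Literature.NumberTheory.Automorphic.ArchColumnUnitaryRep
import Literature.Analysis.UnboundedOperators.UnitaryRepSpectralSeminorm
import Mathlib.MeasureTheory.Integral.MeanInequalities
import HarnessLib

/-!
# The slab lemma: column spectral measures of corner-smoothed vectors are dominated by orbit volumes

Topic `NumberTheory/Automorphic`; namespace `Literature.NumberTheory.Automorphic`. Theorems only (no
definition, no named fact), continuing `ArchColumnUnitaryRep`. Let `τ` be a unitary strongly
continuous representation of `G_∞ = GL_{m+1}(K_∞)` on a Hilbert space `E`, `υ = archColRep` the
unitary representation of the column group `U_{m+1} ≅ K_∞^m`, `μ_v` the Stone–Bochner spectral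
measures for the character form `B_m = archColForm K m` (frequencies are ROW vectors `ξ`, moved by the
corner `diag(h, 1)` through `ξ ↦ ξ h⁻¹`, `spectralMeasure_archColRep_cornerSucc`). For a family of
vectors `Φ(h)` supported on a set `T ⊆ GL_m(K_∞)` of finite Haar measure, whose spectral measures are
dominated by one finite measure `ν`, the corner average `w = ∫ τ(diag(h,1)) Φ(h) dh` satisfies

  `μ_w(S) ≤ |T| · sup_ξ |{h ∈ T | ξ h⁻¹ ∈ S}| · ν(K_∞^m)`      (`spectralMeasure_cornerAverage_le`)

for every Borel `S` (Haar volumes `|·|`). Proof: the spectral measure of a set is the square of a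
seminorm (`UnitaryRep.spectralSeminorm`) obeying Minkowski's inequality for Bochner integrals
(`spectralSeminorm_integral_le`); the covariance `μ_{τ(diag(h,1))u}(S) = μ_u({ξ | ξ h⁻¹ ∈ S})`;
Cauchy–Schwarz on `T`; Tonelli. This is the measure-theoretic half of the "slab lemma" of the Mackey
analysis of the mirabolic subgroup (the spectral measures of smoothed vectors have bounded density on
the open orbit of the generic frequency — the geometric half, `|{h ∈ T | ξ h⁻¹ ∈ S}| ≤ C_T Leb(S)` for
`S` in an annulus, is separate), on the route to Jacquet–Shalika's Kirillov bound in ranks `≥ 3`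
(`JacquetShalika1981_archKirillovNorm_le`; Jacquet–Shalika (1981), §3 (3.5)–(3.8); Folland (1995),
§6.4 for the system of imprimitivity of `GL_m ⋉ ℝ^m`).

## References

* H. Jacquet, J. A. Shalika, *On Euler products and the classification of automorphic
  representations I*, Amer. J. Math. 103 (1981), §3, (3.5)–(3.8) [JacquetShalikaAJM1981].
* G. B. Folland, *A course in abstract harmonic analysis* (1995), Thm. 1.47, Thm. 4.44, §6.4
  [Folland1995].
-/

noncomputable section

open MeasureTheory Measure NumberField NumberField.mixedEmbedding Matrix Set
open scoped MatrixGroups InnerProductSpace Classical ENNReal NNReal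

namespace Literature.NumberTheory.Automorphic

open Literature.Analysis.UnboundedOperators

variable {K : Type} [Field K] [NumberField K] {m : ℕ}

attribute [local instance] glInfBorel borelSpace_glInf locallyCompactSpace_glInf secondCountableTopology_glInf
  borelSpace_pi_mixedSpace

/-! ### 1. Measurability of the orbit relation `ξ h⁻¹ ∈ S` -/

omit [NumberField K] in
/-- `(h, ξ) ↦ ξ h⁻¹` is continuous on `GL_m(K_∞) × K_∞^m`. [folklore] -/
theorem continuous_vecMul_inv :
    Continuous fun p : GL (Fin m) (mixedSpace K) × (Fin m → mixedSpace K) =>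
      p.2 ᵥ* (((p.1⁻¹ : GL (Fin m) (mixedSpace K)) : Matrix (Fin m) (Fin m) (mixedSpace K))) :=
  Continuous.matrix_vecMul continuous_snd (Units.continuous_val.comp (continuous_inv.comp continuous_fst))

/-- The orbit relation `{(h, ξ) | ξ h⁻¹ ∈ S}` is a Borel set for Borel `S`. [folklore] -/
theorem measurableSet_vecMul_inv_mem {S : Set (Fin m → mixedSpace K)} (hS : MeasurableSet S) :
    MeasurableSet {p : GL (Fin m) (mixedSpace K) × (Fin m → mixedSpace K) |
      p.2 ᵥ* (((p.1⁻¹ : GL (Fin m) (mixedSpace K)) : Matrix (Fin m) (Fin m) (mixedSpace K))) ∈ S} :=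
  (continuous_vecMul_inv (K := K) (m := m)).measurable hS

/-- For fixed `h`, `{ξ | ξ h⁻¹ ∈ S}` is Borel. [folklore] -/
theorem measurableSet_vecMul_inv_mem_left {S : Set (Fin m → mixedSpace K)} (hS : MeasurableSet S)
    (h : GL (Fin m) (mixedSpace K)) :
    MeasurableSet {ξ : Fin m → mixedSpace K | ξ ᵥ* (((h⁻¹ : GL (Fin m) (mixedSpace K)) : Matrix (Fin m) (Fin m) (mixedSpace K))) ∈ S} :=
  (LinearMap.continuous_of_finiteDimensional (rowVecMulLin (((h⁻¹ : GL (Fin m) (mixedSpace K)) :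
    Matrix (Fin m) (Fin m) (mixedSpace K))))).measurable hS

/-- For fixed `ξ`, `{h | ξ h⁻¹ ∈ S}` is Borel. [folklore] -/
theorem measurableSet_vecMul_inv_mem_right {S : Set (Fin m → mixedSpace K)} (hS : MeasurableSet S)
    (ξ : Fin m → mixedSpace K) :
    MeasurableSet {h : GL (Fin m) (mixedSpace K) | ξ ᵥ* (((h⁻¹ : GL (Fin m) (mixedSpace K)) : Matrix (Fin m) (Fin m) (mixedSpace K))) ∈ S} :=
  ((continuous_vecMul_inv (K := K) (m := m)).comp (continuous_id.prodMk continuous_const)).measurable hS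

/-! ### 2. Covariance, setwise -/

variable {hcpt : isCompact_glFiniteIntegralLevel (m + 1) K}
  {E : Type*} [NormedAddCommGroup E] [InnerProductSpace ℂ E] [CompleteSpace E]
  {τ : ContRepresentation ℂ (AutomorphyDatum.gl (m + 1) K hcpt).arch.carrier E}
  (hτ : τ.IsStronglyContinuous) (hτu : τ.IsUnitary)

/-- **Covariance, setwise**: `μ_{τ(diag(h,1)) u}(S) = μ_u({ξ | ξ h⁻¹ ∈ S})`. [cite: Folland1995, Thm. 4.44] -/
theorem spectralMeasure_cornerSucc_apply (u : E) (h : GL (Fin m) (mixedSpace K)) {S : Set (Fin m → mixedSpace K)}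
    (hS : MeasurableSet S) :
    (archColRep hτ hτu).spectralMeasure (archColForm K m) archColForm_nondegenerate
        (τ (toArch hcpt (GLn.cornerSucc (mixedSpace K) h)) u) S =
      (archColRep hτ hτu).spectralMeasure (archColForm K m) archColForm_nondegenerate u
        {ξ | ξ ᵥ* (((h⁻¹ : GL (Fin m) (mixedSpace K)) : Matrix (Fin m) (Fin m) (mixedSpace K))) ∈ S} := by
  rw [spectralMeasure_archColRep_cornerSucc hτ hτu h u,
    Measure.map_apply (LinearMap.continuous_of_finiteDimensional _).measurable hS]
  rfl

/-! ### 3. The slab lemma -/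

/-- **Tonelli for the orbit relation**: `∫_T ν({ξ | ξ h⁻¹ ∈ S}) dh = ∫ |{h ∈ T | ξ h⁻¹ ∈ S}| dν(ξ)`.
[folklore] -/
theorem lintegral_measure_vecMul_inv_mem (ν : Measure (Fin m → mixedSpace K)) [SFinite ν]
    {T : Set (GL (Fin m) (mixedSpace K))} (hT : MeasurableSet T) {S : Set (Fin m → mixedSpace K)}
    (hS : MeasurableSet S) :
    ∫⁻ h in T, ν {ξ | ξ ᵥ* (((h⁻¹ : GL (Fin m) (mixedSpace K)) : Matrix (Fin m) (Fin m) (mixedSpace K))) ∈ S}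
        ∂(archHaar m K) =
      ∫⁻ ξ, archHaar m K (T ∩ {h | ξ ᵥ* (((h⁻¹ : GL (Fin m) (mixedSpace K)) :
        Matrix (Fin m) (Fin m) (mixedSpace K))) ∈ S}) ∂ν := by
  set M : Set (GL (Fin m) (mixedSpace K) × (Fin m → mixedSpace K)) :=
    {p | p.2 ᵥ* (((p.1⁻¹ : GL (Fin m) (mixedSpace K)) : Matrix (Fin m) (Fin m) (mixedSpace K))) ∈ S} with hM
  have hMm : MeasurableSet M := measurableSet_vecMul_inv_mem hS
  have hTM : MeasurableSet ((T ×ˢ (univ : Set (Fin m → mixedSpace K))) ∩ M) := (hT.prod MeasurableSet.univ).inter hMm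
  -- both sides are the iterated integrals of the indicator of `(T × univ) ∩ M`
  have h1 : ∫⁻ h in T, ν {ξ | ξ ᵥ* (((h⁻¹ : GL (Fin m) (mixedSpace K)) : Matrix (Fin m) (Fin m) (mixedSpace K))) ∈ S}
      ∂(archHaar m K) = ∫⁻ h, ∫⁻ ξ, ((T ×ˢ univ) ∩ M).indicator 1 (h, ξ) ∂ν ∂(archHaar m K) := by
    rw [← lintegral_indicator hT]
    refine lintegral_congr fun h => ?_
    by_cases hh : h ∈ T
    · rw [indicator_of_mem hh, ← lintegral_indicator_one (measurableSet_vecMul_inv_mem_left hS h)]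
      refine lintegral_congr fun ξ => ?_
      simp only [indicator, mem_inter_iff, mem_prod, mem_univ, and_true, hh, true_and, hM, mem_setOf_eq,
        Pi.one_apply]
    · rw [indicator_of_notMem hh]
      refine (lintegral_eq_zero_of_ae_eq_zero (ae_of_all _ fun ξ => ?_)).symm
      simp [indicator, hh]
  have h2 : ∫⁻ ξ, archHaar m K (T ∩ {h | ξ ᵥ* (((h⁻¹ : GL (Fin m) (mixedSpace K)) :
      Matrix (Fin m) (Fin m) (mixedSpace K))) ∈ S}) ∂ν =
      ∫⁻ ξ, ∫⁻ h, ((T ×ˢ univ) ∩ M).indicator 1 (h, ξ) ∂(archHaar m K) ∂ν := by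
    refine lintegral_congr fun ξ => ?_
    rw [← lintegral_indicator_one (hT.inter (measurableSet_vecMul_inv_mem_right hS ξ))]
    refine lintegral_congr fun h => ?_
    simp only [indicator, mem_inter_iff, mem_prod, mem_univ, and_true, hM, mem_setOf_eq, Pi.one_apply]
  rw [h1, h2]
  exact lintegral_lintegral_swap ((measurable_one.indicator hTM).aemeasurable)

/-- **The slab lemma (measure-theoretic half).** Let `Φ : GL_m(K_∞) → E` vanish off a Borel set `T`
of finite Haar measure, with `h ↦ τ(diag(h,1)) Φ(h)` Bochner integrable, and suppose the column
spectral measures of the `Φ(h)`, `h ∈ T`, are dominated by one finite measure `ν`. Then the corner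
average `w = ∫ τ(diag(h,1)) Φ(h) dh` has column spectral measure
`μ_w(S) ≤ |T| · (sup_ξ |{h ∈ T | ξ h⁻¹ ∈ S}|) · ν(K_∞^m)` for every Borel `S`: Minkowski for the
spectral seminorm, covariance, Cauchy–Schwarz on `T`, Tonelli. With the geometric bound
`|{h ∈ T | ξ h⁻¹ ∈ S}| ≤ C_T Leb(S)` (for `S` in a fixed annulus) this says that `μ_w` has bounded
density on annuli — the system of imprimitivity of the mirabolic `GL_m ⋉ K_∞^m` seen on smoothed
vectors. [cite: Folland1995, Thm. 4.44 and §6.4] [cite: JacquetShalikaAJM1981, §3, (3.5)–(3.8)] -/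
theorem spectralMeasure_cornerAverage_le (Φ : GL (Fin m) (mixedSpace K) → E)
    {T : Set (GL (Fin m) (mixedSpace K))} (hT : MeasurableSet T) (hTfin : archHaar m K T ≠ ⊤)
    (hΦT : ∀ h ∉ T, Φ h = 0)
    (hF : Integrable (fun h => τ (toArch hcpt (GLn.cornerSucc (mixedSpace K) h)) (Φ h)) (archHaar m K))
    (ν : Measure (Fin m → mixedSpace K)) [IsFiniteMeasure ν]
    (hdom : ∀ h ∈ T, (archColRep hτ hτu).spectralMeasure (archColForm K m) archColForm_nondegenerate (Φ h) ≤ ν)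
    {S : Set (Fin m → mixedSpace K)} (hS : MeasurableSet S) :
    (archColRep hτ hτu).spectralMeasure (archColForm K m) archColForm_nondegenerate
        (∫ h, τ (toArch hcpt (GLn.cornerSucc (mixedSpace K) h)) (Φ h) ∂(archHaar m K)) S ≤
      archHaar m K T *
        (⨆ ξ : Fin m → mixedSpace K, archHaar m K (T ∩ {h | ξ ᵥ* (((h⁻¹ : GL (Fin m) (mixedSpace K)) :
          Matrix (Fin m) (Fin m) (mixedSpace K))) ∈ S})) * ν univ := by
  -- notation
  set U := archColRep hτ hτu with hU
  set Bm := archColForm K m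
  have hBm : Bm.Nondegenerate := archColForm_nondegenerate
  set p := U.spectralSeminorm Bm archColForm_nondegenerate S with hp
  set F : GL (Fin m) (mixedSpace K) → E := fun h => τ (toArch hcpt (GLn.cornerSucc (mixedSpace K) h)) (Φ h) with hFdef
  set w := ∫ h, F h ∂(archHaar m K) with hw
  set A : GL (Fin m) (mixedSpace K) → Set (Fin m → mixedSpace K) := fun h =>
    {ξ | ξ ᵥ* (((h⁻¹ : GL (Fin m) (mixedSpace K)) : Matrix (Fin m) (Fin m) (mixedSpace K))) ∈ S} with hA
  set G : ℝ≥0∞ := ⨆ ξ : Fin m → mixedSpace K, archHaar m K (T ∩ {h | ξ ᵥ* (((h⁻¹ : GL (Fin m) (mixedSpace K)) :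
      Matrix (Fin m) (Fin m) (mixedSpace K))) ∈ S}) with hG
  set g : GL (Fin m) (mixedSpace K) → ℝ := fun h => Real.sqrt ((ν (A h)).toReal) with hg
  haveI hTres : IsFiniteMeasure ((archHaar m K).restrict T) := ⟨by rwa [Measure.restrict_apply_univ, lt_top_iff_ne_top]⟩
  -- Step 1 (Minkowski): `p w ≤ ∫ p (F h) dh`
  have step1 : p w ≤ ∫ h, p (F h) ∂(archHaar m K) := U.spectralSeminorm_integral_le Bm hBm S hF
  -- Step 2 (covariance + domination): `p (F h) ≤ 1_T(h) g(h)`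
  have hpF : ∀ h, p (F h) ≤ T.indicator g h := by
    intro h
    by_cases hh : h ∈ T
    · rw [indicator_of_mem hh, hg, hp, UnitaryRep.spectralSeminorm_apply]
      refine Real.sqrt_le_sqrt ?_
      rw [Measure.real, hFdef]
      dsimp only
      rw [spectralMeasure_cornerSucc_apply hτ hτu (Φ h) h hS]
      exact ENNReal.toReal_mono (measure_ne_top ν _) (hdom h hh _)
    · rw [indicator_of_notMem hh, hFdef]
      dsimp only
      rw [hΦT h hh, map_zero, map_zero]
  have hg_nonneg : ∀ h, 0 ≤ g h := fun h => Real.sqrt_nonneg _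
  have hg_bdd : ∀ h, g h ≤ Real.sqrt ((ν univ).toReal) := fun h =>
    Real.sqrt_le_sqrt (ENNReal.toReal_mono (measure_ne_top ν _) (measure_mono (subset_univ _)))
  -- measurability of `h ↦ ν (A h)`
  have hνA_meas : Measurable fun h => ν (A h) := by
    have hMm : MeasurableSet {p : GL (Fin m) (mixedSpace K) × (Fin m → mixedSpace K) |
        p.2 ᵥ* (((p.1⁻¹ : GL (Fin m) (mixedSpace K)) : Matrix (Fin m) (Fin m) (mixedSpace K))) ∈ S} :=
      measurableSet_vecMul_inv_mem hS
    exact measurable_measure_prodMk_left hMm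
  have hg_meas : Measurable g := (hνA_meas.ennreal_toReal).sqrt
  have hg_int : Integrable (T.indicator g) (archHaar m K) := by
    refine (integrable_indicator_iff hT).2 ?_
    refine Measure.integrableOn_of_bounded (M := Real.sqrt ((ν univ).toReal)) hTfin hg_meas.aestronglyMeasurable ?_
    exact ae_of_all _ fun h => by rw [Real.norm_of_nonneg (hg_nonneg h)]; exact hg_bdd h
  have step2 : ∫ h, p (F h) ∂(archHaar m K) ≤ ∫ h in T, g h ∂(archHaar m K) := by
    rw [← integral_indicator hT]
    refine integral_mono_of_nonneg (ae_of_all _ fun h => apply_nonneg p _) hg_int (ae_of_all _ hpF)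
  -- Step 3 (Cauchy–Schwarz on `T`): `(∫_T g)² ≤ |T| ∫_T g²`
  have step3 : (∫ h in T, g h ∂(archHaar m K)) ^ 2 ≤
      (archHaar m K T).toReal * ∫ h in T, (ν (A h)).toReal ∂(archHaar m K) := by
    have hpq : Real.HolderConjugate 2 2 := by
      rw [Real.holderConjugate_iff]; norm_num
    have hone : MemLp (fun _ : GL (Fin m) (mixedSpace K) => (1 : ℝ)) (ENNReal.ofReal 2) ((archHaar m K).restrict T) :=
      memLp_const 1
    have hgL : MemLp g (ENNReal.ofReal 2) ((archHaar m K).restrict T) :=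
      MemLp.of_bound hg_meas.aestronglyMeasurable (Real.sqrt ((ν univ).toReal))
        (ae_of_all _ fun h => by rw [Real.norm_of_nonneg (hg_nonneg h)]; exact hg_bdd h)
    have hCS := integral_mul_le_Lp_mul_Lq_of_nonneg hpq (ae_of_all _ fun _ => zero_le_one)
      (ae_of_all _ fun h => hg_nonneg h) hone hgL
    have hg2 : ∫ h in T, g h ^ (2 : ℝ) ∂(archHaar m K) = ∫ h in T, (ν (A h)).toReal ∂(archHaar m K) := by
      refine integral_congr_ae (ae_of_all _ fun h => ?_)
      dsimp only [hg]
      rw [Real.rpow_two, Real.sq_sqrt ENNReal.toReal_nonneg]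
    simp only [one_mul, Real.one_rpow, mul_one, integral_const, smul_eq_mul, measureReal_restrict_apply_univ,
      hg2] at hCS
    have hI : 0 ≤ ∫ h in T, (ν (A h)).toReal ∂(archHaar m K) := integral_nonneg fun _ => ENNReal.toReal_nonneg
    have hTnn : 0 ≤ (archHaar m K).real T := measureReal_nonneg
    have hint0 : 0 ≤ ∫ h in T, g h ∂(archHaar m K) := integral_nonneg fun h => hg_nonneg h
    have hsq := pow_le_pow_left₀ hint0 hCS 2
    rw [mul_pow, ← Real.rpow_natCast ((archHaar m K).real T ^ (1 / 2 : ℝ)),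
      ← Real.rpow_natCast ((∫ h in T, (ν (A h)).toReal ∂(archHaar m K)) ^ (1 / 2 : ℝ)),
      ← Real.rpow_mul hTnn, ← Real.rpow_mul hI] at hsq
    norm_num at hsq
    exact hsq
  -- Step 4 (Tonelli): `∫_T ν(A h) dh ≤ G · ν(univ)`
  have step4 : ∫⁻ h in T, ν (A h) ∂(archHaar m K) ≤ G * ν univ := by
    rw [hA]
    dsimp only
    rw [lintegral_measure_vecMul_inv_mem ν hT hS]
    calc ∫⁻ ξ, archHaar m K (T ∩ {h | ξ ᵥ* (((h⁻¹ : GL (Fin m) (mixedSpace K)) :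
            Matrix (Fin m) (Fin m) (mixedSpace K))) ∈ S}) ∂ν
        ≤ ∫⁻ _ξ, G ∂ν := lintegral_mono fun ξ => le_iSup (fun ξ : Fin m → mixedSpace K =>
            archHaar m K (T ∩ {h | ξ ᵥ* (((h⁻¹ : GL (Fin m) (mixedSpace K)) :
              Matrix (Fin m) (Fin m) (mixedSpace K))) ∈ S})) ξ
      _ = G * ν univ := by rw [lintegral_const]
  have hGfin : G ≠ ⊤ := by
    refine ne_top_of_le_ne_top hTfin (iSup_le fun ξ => measure_mono inter_subset_left)
  have step4' : ∫ h in T, (ν (A h)).toReal ∂(archHaar m K) ≤ (G * ν univ).toReal := by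
    rw [integral_toReal hνA_meas.aemeasurable (ae_of_all _ fun h => measure_lt_top ν _)]
    exact ENNReal.toReal_mono (ENNReal.mul_ne_top hGfin (measure_ne_top ν _)) step4
  -- assemble in `ℝ`, then return to `ℝ≥0∞`
  have hreal : (U.spectralMeasure Bm hBm w).real S ≤ (archHaar m K T).toReal * (G * ν univ).toReal := by
    rw [← U.spectralSeminorm_sq Bm hBm S w, ← hp]
    have h12 : p w ≤ ∫ h in T, g h ∂(archHaar m K) := step1.trans step2
    have hpw : 0 ≤ p w := apply_nonneg p w
    calc p w ^ 2 ≤ (∫ h in T, g h ∂(archHaar m K)) ^ 2 := by gcongr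
      _ ≤ (archHaar m K T).toReal * ∫ h in T, (ν (A h)).toReal ∂(archHaar m K) := step3
      _ ≤ (archHaar m K T).toReal * (G * ν univ).toReal := by gcongr
  have hfin : U.spectralMeasure Bm hBm w S ≠ ⊤ := measure_ne_top _ _
  rw [← ENNReal.ofReal_toReal hfin, ← ENNReal.ofReal_toReal (ENNReal.mul_ne_top (ENNReal.mul_ne_top hTfin hGfin) (measure_ne_top ν _))]
  refine ENNReal.ofReal_le_ofReal ?_
  rw [ENNReal.toReal_mul, ENNReal.toReal_mul]
  rw [ENNReal.toReal_mul] at hreal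
  calc (U.spectralMeasure Bm hBm w S).toReal = (U.spectralMeasure Bm hBm w).real S := rfl
    _ ≤ (archHaar m K T).toReal * (G.toReal * (ν univ).toReal) := hreal
    _ = (archHaar m K T).toReal * G.toReal * (ν univ).toReal := by ring

end Literature.NumberTheory.Automorphic

end
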